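import Mathlib
import Literature.Computability.AlgebraicComplexity.DeterminantalComplexityProofs
import Summits.ValiantsHypothesis.ValiantsHypothesis.Theses.ValuativeGCT

/-!
# Valiant universality with a size bound (toward `NoValuativeFlip`, stmt-ValiantsHypothesis-12629)

Route `ValuativeGCT`, support item `NoValuativeFlip`. The tree's discharge of Valiant's
universality (`exists_hasDetRepr_holds`, `DeterminantalComplexityProofs.lean`) asserts only the
EXISTENCE of an affine determinantal representation. The no-valuative-flip theorem for shapes of
bounded length (`ValuativeGCTNoValuativeFlipBoundedLength`) needs the SIZE of the branching-program
matrix of the monomial expansion: `dc(f) ≤ 1 + Σ_{d ∈ supp f} |d|` (one closed path of `|d|`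
new vertices per monomial `x^d` of positive degree through the common vertex), hence
`dc(f) ≤ 1 + n · #supp(f)` for a form of degree `n`, and `#supp(f) ≤ (n + 1)^{#variables}`.
This file re-runs the tree's gadget induction (Valiant 1979 §2; the determinant identity
`det_pathBorder_add_single` is reused verbatim) keeping track of the number of vertices.

* `hasDetRepr_one_add_sum_degree` — `HasDetRepr f (1 + Σ_{d ∈ f.support} d.degree)`;
* `hasDetRepr_of_isHomogeneous_of_le` — for `f` homogeneous of degree `n` in the variables `σ`,
  `HasDetRepr f m` for every `m ≥ 1 + n (n + 1) ^ |σ|`.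

Sources: L. G. Valiant, *Completeness classes in algebra*, STOC 1979, §2; P. Bürgisser,
*Completeness and Reduction in Algebraic Complexity Theory* (2000), Prop. 2.30, §2.5.
-/

-- `Summit.ValiantsHypothesis.ValiantsHypothesis.…` repeats a component by the D-0017 layout
-- (single-conjunct summit), which the `dupNamespace` linter flags; the name is mandated.
set_option linter.dupNamespace false

noncomputable section

namespace Summit.ValiantsHypothesis.ValiantsHypothesis.Theorems.NoValuativeFlip

open MvPolynomial Matrix
open Literature.Computability.AlgebraicComplexity

variable {k : Type*} [CommRing k] {σ : Type*}

/-! ### Gadgets with a vertex count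

`Gadget B g`, written inline: there is an affine matrix `M` over an index type with at most `B`
elements and a distinguished index `z` such that `det (M + c E_{z,z}) = c + g` for all `c`. -/

/-- The `1 × 1` zero matrix is a gadget for `0` with one vertex. [folklore] -/
theorem gadget_zero_card :
    ∃ (ι : Type) (_ : Fintype ι) (_ : DecidableEq ι) (z : ι) (M : Matrix ι ι (MvPolynomial σ k)),
      Fintype.card ι ≤ 1 ∧ (∀ p q, (M p q).totalDegree ≤ 1) ∧
        ∀ c, (M + Matrix.single z z c).det = c + 0 :=
  ⟨Unit, inferInstance, inferInstance, (), 0, by simp, fun p q => by simp, fun c => by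
    simp [Matrix.det_unique]⟩

/-- Enlarging the vertex budget of a gadget. [folklore] -/
theorem gadget_mono_card {g : MvPolynomial σ k} {B B' : ℕ} (hB : B ≤ B')
    (h : ∃ (ι : Type) (_ : Fintype ι) (_ : DecidableEq ι) (z : ι)
      (M : Matrix ι ι (MvPolynomial σ k)),
      Fintype.card ι ≤ B ∧ (∀ p q, (M p q).totalDegree ≤ 1) ∧
        ∀ c, (M + Matrix.single z z c).det = c + g) :
    ∃ (ι : Type) (_ : Fintype ι) (_ : DecidableEq ι) (z : ι) (M : Matrix ι ι (MvPolynomial σ k)),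
      Fintype.card ι ≤ B' ∧ (∀ p q, (M p q).totalDegree ≤ 1) ∧
        ∀ c, (M + Matrix.single z z c).det = c + g := by
  obtain ⟨ι, _, _, z, M, hcard, hdeg, hdet⟩ := h
  exact ⟨ι, inferInstance, inferInstance, z, M, hcard.trans hB, hdeg, hdet⟩

/-- Adding an affine form `a` to a gadget for `g` (at the entry `(z, z)`) gives a gadget for
`g + a` with the same vertices. [folklore] -/
theorem gadget_add_affine_card {g a : MvPolynomial σ k} (ha : a.totalDegree ≤ 1) {B : ℕ}
    (h : ∃ (ι : Type) (_ : Fintype ι) (_ : DecidableEq ι) (z : ι)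
      (M : Matrix ι ι (MvPolynomial σ k)),
      Fintype.card ι ≤ B ∧ (∀ p q, (M p q).totalDegree ≤ 1) ∧
        ∀ c, (M + Matrix.single z z c).det = c + g) :
    ∃ (ι : Type) (_ : Fintype ι) (_ : DecidableEq ι) (z : ι) (M : Matrix ι ι (MvPolynomial σ k)),
      Fintype.card ι ≤ B ∧ (∀ p q, (M p q).totalDegree ≤ 1) ∧
        ∀ c, (M + Matrix.single z z c).det = c + (g + a) := by
  obtain ⟨ι, _, _, z, M, hcard, hdeg, hdet⟩ := h
  refine ⟨ι, inferInstance, inferInstance, z, M + Matrix.single z z a, hcard, fun p q => ?_,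
    fun c => ?_⟩
  · rw [Matrix.add_apply, Matrix.single_apply]
    split_ifs
    · exact (totalDegree_add _ _).trans (max_le (hdeg p q) ha)
    · rw [add_zero]
      exact hdeg p q
  · rw [add_assoc, ← Matrix.single_add, hdet]
    ring

/-- Adding a product `y_0 y_1 ⋯ y_{t+1}` of at least two affine forms to a gadget for `g` gives a
gadget for `g + ∏_{i<t+2} y_i` with `t + 1` new vertices (the path block of
`det_pathBorder_add_single`). Valiant 1979, §2. -/
theorem gadget_add_prod_card {g : MvPolynomial σ k} (y : ℕ → MvPolynomial σ k)
    (hy : ∀ i, (y i).totalDegree ≤ 1) (t : ℕ) {B : ℕ}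
    (h : ∃ (ι : Type) (_ : Fintype ι) (_ : DecidableEq ι) (z : ι)
      (M : Matrix ι ι (MvPolynomial σ k)),
      Fintype.card ι ≤ B ∧ (∀ p q, (M p q).totalDegree ≤ 1) ∧
        ∀ c, (M + Matrix.single z z c).det = c + g) :
    ∃ (ι : Type) (_ : Fintype ι) (_ : DecidableEq ι) (z : ι) (M : Matrix ι ι (MvPolynomial σ k)),
      Fintype.card ι ≤ B + (t + 1) ∧ (∀ p q, (M p q).totalDegree ≤ 1) ∧
        ∀ c, (M + Matrix.single z z c).det = c + (g + ∏ i ∈ Finset.range (t + 2), y i) := by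
  obtain ⟨ι, _, _, z, M, hcard, hdeg, hdet⟩ := h
  let U : Matrix (Fin (t + 1)) (Fin (t + 1)) (MvPolynomial σ k) := Matrix.of fun a b =>
    if (b : ℕ) = a then 1 else if (b : ℕ) = a + 1 then -y b else 0
  let W : Matrix (Fin (t + 1)) (Fin (t + 1)) (MvPolynomial σ k) := Matrix.of fun a b =>
    if (a : ℕ) ≤ b then ∏ i ∈ Finset.Ioc (a : ℕ) b, y i else 0
  have hU : ∀ a b, U a b = if (b : ℕ) = a then 1 else if (b : ℕ) = a + 1 then -y b else 0 :=
    fun a b => rfl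
  have hW : ∀ a b, W a b = if (a : ℕ) ≤ b then ∏ i ∈ Finset.Ioc (a : ℕ) b, y i else 0 :=
    fun a b => rfl
  refine ⟨ι ⊕ Fin (t + 1), inferInstance, inferInstance, Sum.inl z,
    Matrix.fromBlocks M (Matrix.single z (0 : Fin (t + 1)) (-y 0))
      (Matrix.single (Fin.last t) z (y (t + 1))) U, ?_, ?_, fun c => ?_⟩
  · rw [Fintype.card_sum, Fintype.card_fin]
    omega
  · rintro (p | p) (q | q)
    · rw [Matrix.fromBlocks_apply₁₁]
      exact hdeg p q
    · rw [Matrix.fromBlocks_apply₁₂, Matrix.single_apply]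
      split_ifs
      · rw [totalDegree_neg]
        exact hy 0
      · simp
    · rw [Matrix.fromBlocks_apply₂₁, Matrix.single_apply]
      split_ifs
      · exact hy (t + 1)
      · simp
    · rw [Matrix.fromBlocks_apply₂₂, hU]
      split_ifs
      · simp
      · rw [totalDegree_neg]
        exact hy q
      · simp
  · rw [det_pathBorder_add_single M z y c hU hW, hdet]
    ring

/-- Adding the product of a list `l` of affine forms to a gadget costs `l.length - 1` new
vertices (none for lists of length `≤ 1`, whose product is affine). Valiant 1979, §2. -/
theorem gadget_add_listProd_card {g : MvPolynomial σ k} (l : List (MvPolynomial σ k))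
    (hl : ∀ y ∈ l, y.totalDegree ≤ 1) {B : ℕ}
    (h : ∃ (ι : Type) (_ : Fintype ι) (_ : DecidableEq ι) (z : ι)
      (M : Matrix ι ι (MvPolynomial σ k)),
      Fintype.card ι ≤ B ∧ (∀ p q, (M p q).totalDegree ≤ 1) ∧
        ∀ c, (M + Matrix.single z z c).det = c + g) :
    ∃ (ι : Type) (_ : Fintype ι) (_ : DecidableEq ι) (z : ι) (M : Matrix ι ι (MvPolynomial σ k)),
      Fintype.card ι ≤ B + (l.length - 1) ∧ (∀ p q, (M p q).totalDegree ≤ 1) ∧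
        ∀ c, (M + Matrix.single z z c).det = c + (g + l.prod) := by
  rcases l with _ | ⟨x, _ | ⟨x', rest⟩⟩
  · rw [List.prod_nil]
    exact gadget_mono_card (by simp) (gadget_add_affine_card (by simp) h)
  · rw [List.prod_cons, List.prod_nil, mul_one]
    exact gadget_mono_card (by simp) (gadget_add_affine_card (hl x (by simp)) h)
  · have hy : ∀ i, ((x :: x' :: rest).getD i 1).totalDegree ≤ 1 := by
      intro i
      rw [List.getD_eq_getElem?_getD]
      by_cases hi : i < (x :: x' :: rest).length
      · rw [List.getElem?_eq_getElem hi, Option.getD_some]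
        exact hl _ (List.getElem_mem hi)
      · rw [List.getElem?_eq_none (by omega), Option.getD_none]
        simp
    have := gadget_add_prod_card (fun i => (x :: x' :: rest).getD i 1) hy rest.length h
    rw [show rest.length + 2 = (x :: x' :: rest).length by simp, prod_range_getD_one] at this
    simpa only [List.length_cons, Nat.add_sub_cancel] using this

/-- A monomial `c x^d` as the product of the list `C c :: (variables of d, with multiplicity)`.
[folklore] -/
theorem prod_C_cons_toList_map_X (d : σ →₀ ℕ) (c : k) :
    (C c :: (d.toMultiset.map X).toList).prod = (monomial d c : MvPolynomial σ k) := by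
  classical
  rw [List.prod_cons, Multiset.prod_toList, Finsupp.toMultiset_map, Finsupp.prod_toMultiset,
    Finsupp.prod_mapDomain_index (fun _ => pow_zero _) (fun _ _ _ => pow_add _ _ _)]
  rw [show (d.prod fun i n => (X i : MvPolynomial σ k) ^ n) = monomial d 1 from
    prod_X_pow_eq_monomial, C_mul_monomial, mul_one]

/-- Adding a monomial `c x^d` to a gadget costs `|d| = d.degree` new vertices. Valiant 1979, §2. -/
theorem gadget_add_monomial_card {g : MvPolynomial σ k} (d : σ →₀ ℕ) (c : k) {B : ℕ}
    (h : ∃ (ι : Type) (_ : Fintype ι) (_ : DecidableEq ι) (z : ι)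
      (M : Matrix ι ι (MvPolynomial σ k)),
      Fintype.card ι ≤ B ∧ (∀ p q, (M p q).totalDegree ≤ 1) ∧
        ∀ c, (M + Matrix.single z z c).det = c + g) :
    ∃ (ι : Type) (_ : Fintype ι) (_ : DecidableEq ι) (z : ι) (M : Matrix ι ι (MvPolynomial σ k)),
      Fintype.card ι ≤ B + d.degree ∧ (∀ p q, (M p q).totalDegree ≤ 1) ∧
        ∀ c', (M + Matrix.single z z c').det = c' + (g + monomial d c) := by
  classical
  have hl : ∀ y ∈ (C c :: (d.toMultiset.map X).toList), y.totalDegree ≤ 1 := by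
    intro y hy
    rw [List.mem_cons] at hy
    rcases hy with rfl | hy
    · simp [totalDegree_C]
    · rw [Multiset.mem_toList, Multiset.mem_map] at hy
      obtain ⟨i, _, rfl⟩ := hy
      exact (isHomogeneous_X k i).totalDegree_le
  have := gadget_add_listProd_card (C c :: (d.toMultiset.map X).toList) hl h
  rw [prod_C_cons_toList_map_X] at this
  refine gadget_mono_card (le_of_eq ?_) this
  simp only [List.length_cons, Multiset.length_toList, Multiset.card_map, Finsupp.card_toMultiset,
    Nat.add_sub_cancel]
  rw [Finsupp.degree_apply]
  rfl

/-- Adding a sum of monomials `Σ_{d ∈ T} c_d x^d` to a gadget costs `Σ_{d ∈ T} |d|` new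
vertices. Valiant 1979, §2 (one path per monomial). -/
theorem gadget_add_sum_monomial_card {g : MvPolynomial σ k} (T : Finset (σ →₀ ℕ))
    (c : (σ →₀ ℕ) → k) {B : ℕ}
    (h : ∃ (ι : Type) (_ : Fintype ι) (_ : DecidableEq ι) (z : ι)
      (M : Matrix ι ι (MvPolynomial σ k)),
      Fintype.card ι ≤ B ∧ (∀ p q, (M p q).totalDegree ≤ 1) ∧
        ∀ c, (M + Matrix.single z z c).det = c + g) :
    ∃ (ι : Type) (_ : Fintype ι) (_ : DecidableEq ι) (z : ι) (M : Matrix ι ι (MvPolynomial σ k)),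
      Fintype.card ι ≤ B + ∑ d ∈ T, d.degree ∧ (∀ p q, (M p q).totalDegree ≤ 1) ∧
        ∀ c', (M + Matrix.single z z c').det = c' + (g + ∑ d ∈ T, monomial d (c d)) := by
  classical
  induction T using Finset.induction_on with
  | empty => simpa using h
  | insert d T hd ih =>
    obtain ⟨ι, _, _, z, M, hcard, hdeg, hdet⟩ := gadget_add_monomial_card d (c d) ih
    refine ⟨ι, inferInstance, inferInstance, z, M, ?_, hdeg, fun c' => ?_⟩
    · rw [Finset.sum_insert hd]
      omega
    · rw [hdet c', Finset.sum_insert hd]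
      ring

/-- **Valiant universality with the monomial-expansion size.** Every polynomial `f` is the
determinant of an affine matrix of size `1 + Σ_{d ∈ supp f} |d|` (the algebraic branching
program of its monomial expansion: one vertex `z` and, for each monomial `x^d` of positive degree,
a closed path through `z` with `|d|` new vertices). Valiant 1979, §2; Bürgisser 2000, Prop. 2.30. -/
theorem hasDetRepr_one_add_sum_degree (f : MvPolynomial σ k) :
    HasDetRepr f (1 + ∑ d ∈ f.support, d.degree) := by
  classical
  obtain ⟨ι, _, _, z, M, hcard, hdeg, hdet⟩ :=
    gadget_add_sum_monomial_card f.support (fun d => coeff d f) gadget_zero_card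
  rw [zero_add, ← f.as_sum] at hdet
  have hrepr : HasDetRepr f (Fintype.card ι) := by
    refine ⟨Matrix.reindex (Fintype.equivFin ι) (Fintype.equivFin ι) M, fun i j => ?_, ?_⟩
    · rw [Matrix.reindex_apply, Matrix.submatrix_apply]
      exact hdeg _ _
    · rw [Matrix.det_reindex_self]
      simpa using hdet 0
  exact HasDetRepr.mono_holds hrepr hcard

/-- The support of a form of degree `n` in the variables `σ` has at most `(n + 1) ^ |σ|`
monomials (every exponent is `≤ n`). [folklore] -/
theorem card_support_le_of_isHomogeneous [Fintype σ] {f : MvPolynomial σ k} {n : ℕ}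
    (hf : f.IsHomogeneous n) : f.support.card ≤ (n + 1) ^ Fintype.card σ := by
  classical
  -- inject the support into the functions `σ → Fin (n + 1)`
  have hle : ∀ d ∈ f.support, ∀ i, d i < n + 1 := by
    intro d hd i
    have hdeg : d.degree = n := by
      rw [Finsupp.degree_eq_weight_one]
      exact hf (mem_support_iff.mp hd)
    have : d i ≤ d.degree := by
      rw [Finsupp.degree_eq_sum]
      exact Finset.single_le_sum (fun j _ => Nat.zero_le (d j)) (Finset.mem_univ i)
    omega
  let φ : (σ →₀ ℕ) → (σ → Fin (n + 1)) := fun d i =>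
    ⟨min (d i) n, Nat.lt_succ_of_le (min_le_right _ _)⟩
  have hinj : Set.InjOn φ f.support := by
    intro d hd d' hd' hdd'
    ext i
    have h1 := congrArg (fun g : σ → Fin (n + 1) => ((g i : Fin (n + 1)) : ℕ)) hdd'
    simp only [φ] at h1
    have := hle d hd i
    have := hle d' hd' i
    omega
  calc f.support.card ≤ (Finset.univ : Finset (σ → Fin (n + 1))).card :=
        Finset.card_le_card_of_injOn φ (fun d _ => Finset.mem_univ _) hinj
    _ = (n + 1) ^ Fintype.card σ := by
        rw [Finset.card_univ, Fintype.card_fun, Fintype.card_fin]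

/-- **Size bound for forms.** A form `f` of degree `n` in the variables `σ` has an affine
determinantal representation of every size `m ≥ 1 + n (n + 1) ^ |σ|`
(`hasDetRepr_one_add_sum_degree`, `card_support_le_of_isHomogeneous`, padding
`HasDetRepr.mono_holds`). Valiant 1979, §2. -/
theorem hasDetRepr_of_isHomogeneous_of_le [Fintype σ] {f : MvPolynomial σ k} {n m : ℕ}
    (hf : f.IsHomogeneous n) (hm : 1 + n * (n + 1) ^ Fintype.card σ ≤ m) : HasDetRepr f m := by
  classical
  refine HasDetRepr.mono_holds (hasDetRepr_one_add_sum_degree f) (le_trans ?_ hm)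
  have hsum : ∑ d ∈ f.support, d.degree = n * f.support.card := by
    rw [mul_comm, Finset.sum_const_nat fun d hd => ?_]
    rw [Finsupp.degree_eq_weight_one]
    exact hf (mem_support_iff.mp hd)
  rw [hsum]
  exact Nat.add_le_add_left (Nat.mul_le_mul_left n (card_support_le_of_isHomogeneous hf)) 1

end Summit.ValiantsHypothesis.ValiantsHypothesis.Theorems.NoValuativeFlip

end
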